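import Mathlib
import Summits.Ventures.PercRepro2.Defs
import Summits.Ventures.PercRepro2.Graph
import Summits.Ventures.PercRepro2.OneColourSwitch
import Summits.Ventures.PercRepro2.RegionHubSign
import Summits.Ventures.PercRepro2.SideSwitch
import Summits.Ventures.PercRepro2.SideSwitchFibre
import Summits.Ventures.PercRepro2.SideSwitchComps
import Summits.Ventures.PercRepro2.M9NoPocketDefs
import Summits.Ventures.PercRepro2.M9NoPocketWorld
import Summits.Ventures.PercRepro2.M9NoPocketWorldD
import Summits.Ventures.PercRepro2.M9NoPocketLegal
import Summits.Ventures.PercRepro2.M9NoPocketMono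
import Summits.Ventures.PercRepro2.M9NoPocketCompl
import Summits.Ventures.PercRepro2.M9NoPocketCompl2
import Summits.Ventures.PercRepro2.M9NoPocketFlipRS
import Summits.Ventures.PercRepro2.M9NoPocketHarris
import Summits.Ventures.PercRepro2.M9PsiOneDefs
import Summits.Ventures.PercRepro2.M9NoPocketFreeBlock
import Summits.Ventures.PercRepro2.M9NoPocketFreeBlockK
import Summits.Ventures.PercRepro2.M9NoPocketDeadMono
import Summits.Ventures.PercRepro2.M9NoPocketDeadY
import Summits.Ventures.PercRepro2.M9QuadHarrisPow
import Summits.Ventures.PercRepro2.M9UnitAlgebra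
import Summits.Ventures.PercRepro2.M9NoPocketSameType
import Summits.Ventures.PercRepro2.M9NoPocketDeadPattern
import Summits.Ventures.PercRepro2.M9NoPocketLinkCompl
import Summits.Ventures.PercRepro2.M9NoPocketLinkE
import Summits.Ventures.PercRepro2.M9NoPocketSigmaRS
import Summits.Ventures.PercRepro2.M9NoPocketUnitE
import Summits.Ventures.PercRepro2.M9NoPocketUnitK

/-!
# The one-sided part of a unit: the bound and the count of the linking patterns (blind cell
PercRepro2, p3 g36, 2026-08-29; `proofs/P3-NPHDR.md` §5(e)–(f), in the unit form)

Second half of the one-sided bookkeeping.  With the linking free blocks switched the `σ_pq` of a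
`K`-point drops by at least the drop of `[p ~_Y q]` between the two clean points, because dead
edges do not change `p ~_Y q` and `p ~_W q` only decreases (`A_sub_B_le`:
`A_D − B_D ≤ HY ∅ − HW ∅`); together with `A_D ≤ HY ∅ − HW 𝔑` of `M9NoPocketUnitK`,
**the one-sided sum of a pattern is at most `ℓK D · (HY ∅ − HW 𝔑)`** (`K_add_K_le`).  Finally
the number of linking patterns is at least the number of linking joined `Y`-side sets: the
pattern `D_S` killing every edge of `d` into the blocks outside `S` keeps the link of `S`
(`conn_rs_of_eqOn_within_K2`, a `Y`-path from `r` lives inside the `Y`-world), and `S ↦ D_S`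
is injective on the non-empty joined sets (`sum_link_le_sum_linkK`).  Own work; std axioms.
-/

namespace Summit.Ventures.PercRepro2

namespace NoPocket

open Finset Classical RegionHub OneColourSwitch SideSwitch M9Reduce

variable {V : Type*} {E : Type*}

section UnitK2

variable [Fintype V] [DecidableEq V] [Fintype E] [DecidableEq E] {ends : E → Sym2 V}

/-- **Switching the linking free blocks drops `σ_pq` of a `K`-point at least as much as it
drops `[p ~_Y q]` of the clean point: `A_D − B_D ≤ HY ∅ − HW ∅`.** -/
theorem A_sub_B_le {p q r s d : V} (hnp : NoPocketAt ends d r s) (hpd : p ≠ d) (hqd : q ≠ d)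
    (hr : d ≠ r) (hs : d ≠ s) (hT : Tset ends d r s = ∅) (hloop : ∀ e, ends e ≠ s(d, d))
    (hrs : ∀ e, ends e ≠ s(r, s)) {ρ₀ : Config E} (hρ₀ : ρ₀ ∈ RepD ends p q r s d)
    (hst : ∀ e, d ∈ ends e → ρ₀ e = true) {D : Finset E}
    (hD : D ⊆ univ.filter (fun e => d ∈ ends e)) (hDA : D ≠ univ.filter (fun e => d ∈ ends e))
    {𝔉 𝔉L : Finset (Finset V)}
    (h𝔉 : 𝔉 = (blocks ends d r s ρ₀).filter (fun C => ¬ hasY ends d ρ₀ C))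
    (h𝔉L : 𝔉L = 𝔉.filter (LinksIn ends ρ₀ r s)) :
    (∑ T ∈ 𝔉.powerset.filter (fun T => T ∩ 𝔉L = ∅),
        (sigma ends (assignX ends (T, ∅) (flipF D ρ₀)) p q +
          sigma ends (assignX ends (T, ∅) (flipF D (flipOp ends d r s ρ₀))) p q)) -
      (∑ T ∈ 𝔉.powerset.filter (fun T => 𝔉L ⊆ T),
        (sigma ends (assignX ends (T, ∅) (flipF D ρ₀)) p q +
          sigma ends (assignX ends (T, ∅) (flipF D (flipOp ends d r s ρ₀))) p q)) ≤
      (∑ T ∈ 𝔉.powerset.filter (fun T => T ∩ 𝔉L = ∅),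
          ((if Conn ends (assignX ends (T ∪ ∅, ∅) ρ₀) p q then 1 else 0) +
            (if Conn ends (assignX ends (T ∪ ∅, ∅) (flipOp ends d r s ρ₀)) p q then 1 else 0))) -
        (∑ T ∈ 𝔉.powerset.filter (fun T => 𝔉L ⊆ T),
          ((if Conn ends (assignX ends (T ∪ ∅, ∅) ρ₀) p q then 1 else 0) +
            (if Conn ends (assignX ends (T ∪ ∅, ∅) (flipOp ends d r s ρ₀)) p q
              then 1 else 0))) := by
  have hDd : ∀ e ∈ D, d ∈ ends e := fun e he => (Finset.mem_filter.1 (hD he)).2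
  have hρ₁ := flipOp_mem_RepD hr hs hρ₀
  have hst₁ := sameType_flipOp hnp hr hs hT hloop hρ₀ hst
  have hLf : 𝔉L ⊆ 𝔉 := by rw [h𝔉L]; exact Finset.filter_subset _ _
  rw [← sum_filter_inter_empty_eq_sum_union hLf (fun T =>
      sigma ends (assignX ends (T, ∅) (flipF D ρ₀)) p q +
        sigma ends (assignX ends (T, ∅) (flipF D (flipOp ends d r s ρ₀))) p q),
    ← sum_filter_inter_empty_eq_sum_union hLf (fun T =>
      (if Conn ends (assignX ends (T ∪ ∅, ∅) ρ₀) p q then 1 else 0) +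
        (if Conn ends (assignX ends (T ∪ ∅, ∅) (flipOp ends d r s ρ₀)) p q then 1 else 0)),
    ← Finset.sum_sub_distrib, ← Finset.sum_sub_distrib]
  refine Finset.sum_le_sum (fun T hTp => ?_)
  have hTf : T ⊆ (blocks ends d r s ρ₀).filter (fun C => ¬ hasY ends d ρ₀ C) := by
    rw [← h𝔉]; exact Finset.mem_powerset.1 (Finset.mem_filter.1 hTp).1
  have hTLf : T ∪ 𝔉L ⊆ (blocks ends d r s ρ₀).filter (fun C => ¬ hasY ends d ρ₀ C) := by
    rw [← h𝔉]
    exact Finset.union_subset (Finset.mem_powerset.1 (Finset.mem_filter.1 hTp).1) hLf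
  have hTf₁ : T ⊆ (blocks ends d r s (flipOp ends d r s ρ₀)).filter
      (fun C => ¬ hasY ends d (flipOp ends d r s ρ₀) C) := by
    rw [filter_free_flipOp hr hs]; exact hTf
  have hTLf₁ : T ∪ 𝔉L ⊆ (blocks ends d r s (flipOp ends d r s ρ₀)).filter
      (fun C => ¬ hasY ends d (flipOp ends d r s ρ₀) C) := by
    rw [filter_free_flipOp hr hs]; exact hTLf
  simp only [Finset.union_empty]
  -- the pieces for each representative
  have y0 := conn_pq_K_iff hnp hpd hqd hr hs hT hloop hρ₀ hst hD hDA hTf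
  have y0' := conn_pq_K_iff hnp hpd hqd hr hs hT hloop hρ₀ hst hD hDA hTLf
  have y1 := conn_pq_K_iff hnp hpd hqd hr hs hT hloop hρ₁ hst₁ hD hDA hTf₁
  have y1' := conn_pq_K_iff hnp hpd hqd hr hs hT hloop hρ₁ hst₁ hD hDA hTLf₁
  have w0 := conn_compl_K_anti hnp hpd hqd hr hs hT hrs hρ₀ hst hDd
    (Finset.subset_union_left (s₂ := 𝔉L)) hTLf
  have w1 := conn_compl_K_anti hnp hpd hqd hr hs hT hrs hρ₁ hst₁ hDd
    (Finset.subset_union_left (s₂ := 𝔉L)) hTLf₁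
  simp only [sigma, y0, y0', y1, y1']
  by_cases a0 : Conn ends (assignX ends (T, ∅) ρ₀) p q <;>
    by_cases a1 : Conn ends (assignX ends (T, ∅) (flipOp ends d r s ρ₀)) p q <;>
    by_cases b0 : Conn ends (assignX ends (T ∪ 𝔉L, ∅) ρ₀) p q <;>
    by_cases b1 : Conn ends (assignX ends (T ∪ 𝔉L, ∅) (flipOp ends d r s ρ₀)) p q <;>
    by_cases c0 : Conn ends (OneColourSwitch.compl (assignX ends (T, ∅) (flipF D ρ₀))) p q <;>
    by_cases c1 : Conn ends (OneColourSwitch.compl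
      (assignX ends (T, ∅) (flipF D (flipOp ends d r s ρ₀)))) p q <;>
    by_cases e0 : Conn ends (OneColourSwitch.compl (assignX ends (T ∪ 𝔉L, ∅) (flipF D ρ₀))) p q <;>
    by_cases e1 : Conn ends (OneColourSwitch.compl
      (assignX ends (T ∪ 𝔉L, ∅) (flipF D (flipOp ends d r s ρ₀)))) p q <;>
    simp only [a0, a1, b0, b1, c0, c1, e0, e1, if_true, if_false] <;>
    first
      | omega
      | exact absurd (w0 e0) c0
      | exact absurd (w1 e1) c1

/-- **The one-sided sum of a dead pattern is at most `ℓK D · (HY ∅ − HW 𝔑)`.** -/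
theorem K_add_K_le {p q r s d : V} (hnp : NoPocketAt ends d r s) (hpd : p ≠ d) (hqd : q ≠ d)
    (hr : d ≠ r) (hs : d ≠ s) (hT : Tset ends d r s = ∅) (hloop : ∀ e, ends e ≠ s(d, d))
    (hrs : ∀ e, ends e ≠ s(r, s)) (hrs' : r ≠ s) {ρ₀ : Config E}
    (hρ₀ : ρ₀ ∈ RepD ends p q r s d) (hst : ∀ e, d ∈ ends e → ρ₀ e = true) {D : Finset E}
    (hD : D ⊆ univ.filter (fun e => d ∈ ends e)) (hDA : D ≠ univ.filter (fun e => d ∈ ends e))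
    {𝔉 𝔑 𝔉L : Finset (Finset V)}
    (h𝔉 : 𝔉 = (blocks ends d r s ρ₀).filter (fun C => ¬ hasY ends d ρ₀ C))
    (h𝔑 : 𝔑 = (blocks ends d r s ρ₀).filter (hasY ends d ρ₀))
    (h𝔉L : 𝔉L = 𝔉.filter (LinksIn ends ρ₀ r s))
    (hYW0 : (∑ T ∈ 𝔉.powerset.filter (fun T => T ∩ 𝔉L = ∅),
          ((if Conn ends (assignX ends (T ∪ ∅, ∅) ρ₀) p q then (1 : ℤ) else 0) +
            (if Conn ends (assignX ends (T ∪ ∅, ∅) (flipOp ends d r s ρ₀)) p q then 1 else 0))) ≤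
        (∑ T ∈ 𝔉.powerset.filter (fun T => 𝔉L ⊆ T),
          ((if Conn ends (assignX ends (T ∪ ∅, ∅) ρ₀) p q then 1 else 0) +
            (if Conn ends (assignX ends (T ∪ ∅, ∅) (flipOp ends d r s ρ₀)) p q
              then 1 else 0)))) :
    (∑ T ∈ 𝔉.powerset, sigma ends (assignX ends (T, ∅) (flipF D ρ₀)) p q *
        sigma ends (assignX ends (T, ∅) (flipF D ρ₀)) r s) +
      (∑ T ∈ 𝔉.powerset, sigma ends (assignX ends (T, ∅) (flipF D (flipOp ends d r s ρ₀))) p q *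
        sigma ends (assignX ends (T, ∅) (flipF D (flipOp ends d r s ρ₀))) r s) ≤
      (if Conn ends (assignX ends (𝔉, ∅) (flipF D ρ₀)) r s then 1 else 0) *
        ((∑ T ∈ 𝔉.powerset.filter (fun T => T ∩ 𝔉L = ∅),
            ((if Conn ends (assignX ends (T ∪ ∅, ∅) ρ₀) p q then 1 else 0) +
              (if Conn ends (assignX ends (T ∪ ∅, ∅) (flipOp ends d r s ρ₀)) p q
                then 1 else 0))) -
          (∑ T ∈ 𝔉.powerset.filter (fun T => 𝔉L ⊆ T),
            ((if Conn ends (assignX ends (T ∪ 𝔑, ∅) ρ₀) p q then 1 else 0) +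
              (if Conn ends (assignX ends (T ∪ 𝔑, ∅) (flipOp ends d r s ρ₀)) p q
                then 1 else 0)))) := by
  have hDd : ∀ e ∈ D, d ∈ ends e := fun e he => (Finset.mem_filter.1 (hD he)).2
  rw [K_add_K_eq hnp hr hs hT hloop hrs hrs' hρ₀ hst hDd h𝔉 h𝔉L]
  have hA := A_le hnp hr hs hT hloop hrs hρ₀ hst hDd h𝔉 h𝔑 h𝔉L
  have hAB := A_sub_B_le hnp hpd hqd hr hs hT hloop hrs hρ₀ hst hD hDA h𝔉 h𝔉L
  by_cases hc : Conn ends (assignX ends (𝔉, ∅) (flipF D ρ₀)) r s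
  · simp only [hc, if_true]
    linarith
  · simp only [hc, if_false]
    linarith

omit [Fintype V] [DecidableEq V] [Fintype E] [DecidableEq E] in
/-- A `Y`-path from `r` lives inside the `Y`-world: a colouring agreeing with `ω` on the edges
inside `K₂(ω)` keeps `r ~_Y s`. -/
lemma conn_rs_of_eqOn_within_K2 {r s : V} {ω ω' : Config E}
    (h : ∀ e ∈ within ends (K2 ends r s ω), ω e = ω' e) (hc : Conn ends ω r s) :
    Conn ends ω' r s := by
  have key : s ∈ {z | z ∈ K2 ends r s ω ∧ Conn ends ω' r z} := by
    refine mem_of_conn_of_closed (ends := ends) (ω := ω) ?_ ⟨r_mem_K2 _ _ _, conn_refl _ _ _⟩ hc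
    rintro z ⟨hzK, hz⟩ v hadj
    obtain ⟨_, e, he, hends⟩ := openGraph_adj.1 hadj
    have hvK : v ∈ K2 ends r s ω := mem_K2_of_open hzK he hends
    have he' : ω' e = true := by
      rw [← h e ⟨z, hzK, v, hvK, hends⟩]; exact he
    exact ⟨hvK, conn_trans hz (conn_of_openAdj ⟨e, he', hends⟩)⟩
  exact key.2

/-- The pattern `D_S` of the edges of `d` into the joined blocks outside `S` keeps the link of
the joined `Y`-side set `S`. -/
lemma link_le_linkK {p q r s d : V} (hnp : NoPocketAt ends d r s) (hr : d ≠ r) (hs : d ≠ s)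
    (hT : Tset ends d r s = ∅) {ρ₀ : Config E} (hρ₀ : ρ₀ ∈ RepD ends p q r s d)
    (hst : ∀ e, d ∈ ends e → ρ₀ e = true) {𝔉 𝔑 : Finset (Finset V)}
    (h𝔉 : 𝔉 = (blocks ends d r s ρ₀).filter (fun C => ¬ hasY ends d ρ₀ C))
    (h𝔑 : 𝔑 = (blocks ends d r s ρ₀).filter (hasY ends d ρ₀)) (S : Finset (Finset V))
    (hc : Conn ends (assignX ends (𝔉 ∪ (𝔑 \ S), ∅) ρ₀) r s) :
    Conn ends (assignX ends (𝔉, ∅)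
      (flipF ((univ.filter (fun e => d ∈ ends e)).filter
        (fun e => ∃ C ∈ 𝔑 \ S, ∃ y ∈ C, ends e = s(d, y))) ρ₀)) r s := by
  have hXb : 𝔉 ∪ (𝔑 \ S) ⊆ blocks ends d r s ρ₀ := by
    rw [h𝔉, h𝔑]
    exact Finset.union_subset (Finset.filter_subset _ _)
      (Finset.sdiff_subset.trans (Finset.filter_subset _ _))
  have hF : ((𝔉 ∪ (𝔑 \ S), ∅) : Finset (Finset V) × Finset E).2 ⊆ Tset ends d r s :=
    Finset.empty_subset _
  refine conn_rs_of_eqOn_within_K2 (fun e he => ?_) hc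
  obtain ⟨u, hu, v, hv, hends⟩ := he
  -- the endpoints avoid the switched blocks
  have hnot : ∀ w ∈ K2 ends r s (assignX ends (𝔉 ∪ (𝔑 \ S), ∅) ρ₀), w ∉ unionT (𝔉 ∪ (𝔑 \ S)) := by
    intro w hw
    rw [K2_assignX hnp hρ₀ hXb hF hr hs (fun _ C _ => not_hasW_of_sameType hst C)] at hw
    rcases hw with hw | ⟨rfl, _⟩
    · rw [K2_endsD_assignX hρ₀ hXb hF] at hw
      exact fun h => hw.2 (Finset.mem_coe.2 h)
    · intro h
      obtain ⟨C, hC, hdC⟩ := mem_unionT.1 h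
      exact d_notMem_block hr hs (hXb hC) hdC
  have hu' := hnot u hu
  have hv' := hnot v hv
  have hnt : e ∉ touches ends (↑(unionT (𝔉 ∪ (𝔑 \ S))) : Set V) :=
    not_mem_touches_of_ends hends (fun h => hu' (Finset.mem_coe.1 h))
      (fun h => hv' (Finset.mem_coe.1 h))
  have hnt' : e ∉ touches ends (↑(unionT 𝔉) : Set V) :=
    not_mem_touches_of_ends hends
      (fun h => hu' (unionT_mono Finset.subset_union_left (Finset.mem_coe.1 h)))
      (fun h => hv' (unionT_mono Finset.subset_union_left (Finset.mem_coe.1 h)))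
  have hnD : e ∉ (univ.filter (fun e => d ∈ ends e)).filter
      (fun e => ∃ C ∈ 𝔑 \ S, ∃ y ∈ C, ends e = s(d, y)) := by
    intro h
    obtain ⟨C, hC, y, hyC, hdy⟩ := (Finset.mem_filter.1 h).2
    have hyX : y ∈ unionT (𝔉 ∪ (𝔑 \ S)) :=
      mem_unionT.2 ⟨C, Finset.mem_union_right _ hC, hyC⟩
    rw [hends, Sym2.eq_iff] at hdy
    rcases hdy with ⟨_, rfl⟩ | ⟨rfl, _⟩
    · exact hv' hyX
    · exact hu' hyX
  simp only [assignX, flipTouch, flipF, hnt, hnt', hnD, Finset.notMem_empty, if_false]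

/-- **The number of linking dead patterns is at least the number of linking joined
`Y`-side sets.** -/
theorem sum_link_le_sum_linkK {p q r s d : V} (hnp : NoPocketAt ends d r s) (hr : d ≠ r)
    (hs : d ≠ s) (hT : Tset ends d r s = ∅) (hloop : ∀ e, ends e ≠ s(d, d)) {ρ₀ : Config E}
    (hρ₀ : ρ₀ ∈ RepD ends p q r s d) (hst : ∀ e, d ∈ ends e → ρ₀ e = true)
    {𝔉 𝔑 : Finset (Finset V)}
    (h𝔉 : 𝔉 = (blocks ends d r s ρ₀).filter (fun C => ¬ hasY ends d ρ₀ C))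
    (h𝔑 : 𝔑 = (blocks ends d r s ρ₀).filter (hasY ends d ρ₀)) :
    ∑ S ∈ 𝔑.powerset.filter (fun S => S ≠ ∅),
        (if Conn ends (assignX ends (𝔉 ∪ (𝔑 \ S), ∅) ρ₀) r s then (1 : ℤ) else 0) ≤
      ∑ D ∈ (univ.filter (fun e => d ∈ ends e)).powerset.filter
          (fun D => D ≠ univ.filter (fun e => d ∈ ends e)),
        (if Conn ends (assignX ends (𝔉, ∅) (flipF D ρ₀)) r s then (1 : ℤ) else 0) := by
  -- the pattern of a joined `Y`-side set
  set DS : Finset (Finset V) → Finset E := fun S => (univ.filter (fun e => d ∈ ends e)).filter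
    (fun e => ∃ C ∈ 𝔑 \ S, ∃ y ∈ C, ends e = s(d, y)) with hDS
  -- an edge of `d` into a joined block outside `S'` lies in `DS S'`; if it lies in `DS S`, the
  -- block is outside `S`
  have hedge : ∀ {S S' : Finset (Finset V)}, ∀ {C : Finset V}, C ∈ 𝔑 → C ∉ S' →
      ∃ e ∈ univ.filter (fun e => d ∈ ends e), e ∈ DS S' ∧ (e ∈ DS S → C ∉ S) := by
    intro S S' C hC hCS'
    have hCb : C ∈ blocks ends d r s ρ₀ := by rw [h𝔑] at hC; exact (Finset.mem_filter.1 hC).1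
    have hY : hasY ends d ρ₀ C := by rw [h𝔑] at hC; exact (Finset.mem_filter.1 hC).2
    obtain ⟨e, y, hyC, hends⟩ := (hasY_sameType_iff hst C).1 hY
    have heA : e ∈ univ.filter (fun e => d ∈ ends e) :=
      Finset.mem_filter.2 ⟨Finset.mem_univ _, by rw [hends]; exact Sym2.mem_mk_left _ _⟩
    refine ⟨e, heA, Finset.mem_filter.2 ⟨heA, C, Finset.mem_sdiff.2 ⟨hC, hCS'⟩, y, hyC, hends⟩, ?_⟩
    intro heD hCS
    obtain ⟨C'', hC'', y'', hy''C'', hends''⟩ := (Finset.mem_filter.1 heD).2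
    rw [hends, Sym2.eq_iff] at hends''
    rcases hends'' with ⟨_, rfl⟩ | ⟨hdy, rfl⟩
    · have : C = C'' := blocks_eq_of_shared_vertex hCb
        (by rw [h𝔑] at hC''; exact (Finset.mem_filter.1 (Finset.mem_sdiff.1 hC'').1).1)
        hyC hy''C''
      subst this
      exact (Finset.mem_sdiff.1 hC'').2 hCS
    · exact hloop e (by rw [hends, hdy])
  -- injectivity on the non-empty joined sets
  have hinj : ∀ S ∈ 𝔑.powerset.filter (fun S => S ≠ ∅), ∀ S' ∈ 𝔑.powerset.filter
      (fun S => S ≠ ∅), DS S = DS S' → S = S' := by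
    have hsub : ∀ S S' : Finset (Finset V), S ⊆ 𝔑 → S' ⊆ 𝔑 → DS S = DS S' → S ⊆ S' := by
      intro S S' hS hS' hSS' C hCS
      by_contra hCS'
      obtain ⟨e, _, heD', himp⟩ := hedge (S := S) (hS hCS) hCS'
      rw [← hSS'] at heD'
      exact himp heD' hCS
    intro S hS S' hS' h
    have hS1 := Finset.mem_powerset.1 (Finset.mem_filter.1 hS).1
    have hS2 := Finset.mem_powerset.1 (Finset.mem_filter.1 hS').1
    exact Finset.Subset.antisymm (hsub S S' hS1 hS2 h) (hsub S' S hS2 hS1 h.symm)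
  -- the image lies in the patterns `D ≠ A`
  have himage : (𝔑.powerset.filter (fun S => S ≠ ∅)).image DS ⊆
      (univ.filter (fun e => d ∈ ends e)).powerset.filter
        (fun D => D ≠ univ.filter (fun e => d ∈ ends e)) := by
    intro D hD
    obtain ⟨S, hS, rfl⟩ := Finset.mem_image.1 hD
    obtain ⟨hSp, hS0⟩ := Finset.mem_filter.1 hS
    refine Finset.mem_filter.2 ⟨Finset.mem_powerset.2 (Finset.filter_subset _ _), ?_⟩
    intro hDA
    obtain ⟨C, hCS⟩ := Finset.nonempty_iff_ne_empty.2 hS0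
    have hC : C ∈ 𝔑 := Finset.mem_powerset.1 hSp hCS
    -- the edge of `d` into `C` is in `A = DS S`, so `C ∉ S`
    obtain ⟨e, heA, _, himp⟩ := hedge (S := S) (S' := ∅) hC (Finset.notMem_empty C)
    rw [← hDA] at heA
    exact himp heA hCS
  calc ∑ S ∈ 𝔑.powerset.filter (fun S => S ≠ ∅),
        (if Conn ends (assignX ends (𝔉 ∪ (𝔑 \ S), ∅) ρ₀) r s then (1 : ℤ) else 0)
      ≤ ∑ S ∈ 𝔑.powerset.filter (fun S => S ≠ ∅),
          (if Conn ends (assignX ends (𝔉, ∅) (flipF (DS S) ρ₀)) r s then (1 : ℤ) else 0) := by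
        refine Finset.sum_le_sum (fun S _ => ?_)
        by_cases hc : Conn ends (assignX ends (𝔉 ∪ (𝔑 \ S), ∅) ρ₀) r s
        · have this' : Conn ends (assignX ends (𝔉, ∅) (flipF (DS S) ρ₀)) r s :=
            link_le_linkK hnp hr hs hT hρ₀ hst h𝔉 h𝔑 S hc
          rw [if_pos hc, if_pos this']
        · rw [if_neg hc]
          split_ifs <;> norm_num
    _ = ∑ D ∈ (𝔑.powerset.filter (fun S => S ≠ ∅)).image DS,
          (if Conn ends (assignX ends (𝔉, ∅) (flipF D ρ₀)) r s then (1 : ℤ) else 0) :=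
        (Finset.sum_image (f := fun D => if Conn ends (assignX ends (𝔉, ∅) (flipF D ρ₀)) r s
          then (1 : ℤ) else 0) (g := DS) hinj).symm
    _ ≤ ∑ D ∈ (univ.filter (fun e => d ∈ ends e)).powerset.filter
          (fun D => D ≠ univ.filter (fun e => d ∈ ends e)),
          (if Conn ends (assignX ends (𝔉, ∅) (flipF D ρ₀)) r s then (1 : ℤ) else 0) :=
        Finset.sum_le_sum_of_subset_of_nonneg himage (fun D _ _ => by split_ifs <;> norm_num)

end UnitK2

end NoPocket

end Summit.Ventures.PercRepro2
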